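import Summits.BirchSwinnertonDyer.Rank1Residual.ManinAdditive.SigmaThetaParity
import HarnessLib

/-!
# THE THETA FAMILY `Θ_m` (E-an-157 `ThetaFamilyIntegral`, statement spelled out): `thetaFamily_integral` (an g35, T-an-37, Part A 3/3)

TYPER NOTE (typer g19, TURNKEY T-an-37 v2, part 3/3 of file A).  SOURCE = HOME/an/g35/SigmaThetaParity-an-g35-v2.lean sha16 3284279ff549c8a2,
lines 678–949 = `section ThetaFamily` VERBATIM (one-line docstrings added on four undocumented helper lemmas; = an's stand-alone
ThetaFamily-an-g35.lean 3543d9ed27b0cb75); imports part 1 `SigmaThetaParity` only (uses `two_pow_gcd_two_pow`, `divisor_two_adic`,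
`two_pow_mul_div`).  CONTENT (an's words): `η`-exponent vector `r = 2·thetaVec m` (written out as `thetaBody`, the verbatim body of
`SigmaTheta.thetaVec`, so the by-name theorem is definitional transport): for odd `m`, Newman's conditions and even (integral) cusp orders
hold on `X₀(8m)`, and on `X₀(4m)` the cusp orders are even iff `m ≡ 1 (mod 4)`; the whole content is the closed form
`cuspOrder24 (8m) r (2^i c') = 8 (m − c'²)(4 − 5·4^{min(1,i)} + 4^{min(2,i)})` (zero unless `i = 1`).  Main theorem
`thetaFamily_integral (m) (hm : Odd m) (r) (hr : ∀ t, r t = 2 * thetaBody m t) : (NewmanCond (8*m) r 0 ∧ HasEvenCuspOrders (8*m) r) ∧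
(m % 4 = 1 ↔ HasEvenCuspOrders (4*m) r)`.  The by-name closure `thetaFamilyIntegral_holds` lives in `SigmaThetaHolds.lean`.  Two helper `def`s
(`thetaBody`, `cuspWeight`), otherwise theorems; nothing conjectured.  PARTITION 0 · beyond-print theorem: yes, modest (an: the theta generators
`Θ_m` are on `X₀(8m)`, and on `X₀(4m)` iff `m ≡ 1 (4)`, as kernel theorems) · BSD / C2 / Manin `c = 1` NOT proved by this.
-/

namespace Summit.BirchSwinnertonDyer.Rank1Residual.ManinAdditive.SigmaEta

open Literature.NumberTheory.ModularForms
open Literature.NumberTheory.EllipticCurves.ModularForms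
open scoped NumberTheorySymbols
open ZMod


/-! ### The theta family `Θ_m = θ(τ)²θ(2τ)⁻⁵θ(4τ)²·θ(mτ)⁻²θ(2mτ)⁵θ(4mτ)⁻²` (E-an-157)

`η`-exponent vector `r = 2·thetaVec m` (written out as `thetaBody`, the verbatim body of `SigmaTheta.thetaVec`, so the by-name
theorem is definitional transport): for odd `m`, Newman's conditions and even (integral) cusp orders hold on `X₀(8m)`, and on
`X₀(4m)` the cusp orders are even iff `m ≡ 1 (mod 4)`.  The whole content is the closed form
`cuspOrder24 (8m) r (2^i c') = 8 (m − c'²)(4 − 5·4^{min(1,i)} + 4^{min(2,i)})` (zero unless `i = 1`). -/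

section ThetaFamily

/-- The `η`-exponent vector of `Θ_m` before doubling (verbatim body of `SigmaTheta.thetaVec`). -/
def thetaBody (m t : ℕ) : ℤ :=
  (if t = 1 then 2 else 0) + (if t = 2 then -5 else 0) + (if t = 4 then 2 else 0) +
    (if t = m then -2 else 0) + (if t = 2 * m then 5 else 0) + (if t = 4 * m then -2 else 0)

/-- Pointwise expansion of `r δ · g δ` for the theta exponent vector `r = 2·thetaBody m`. -/
theorem theta_mul_weight (m : ℕ) (r : ℕ → ℤ) (hr : ∀ t, r t = 2 * thetaBody m t) (g : ℕ → ℤ) (δ : ℕ) :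
    r δ * g δ = 2 * ((if δ = 1 then 2 * g δ else 0) + (if δ = 2 then -5 * g δ else 0) +
      (if δ = 4 then 2 * g δ else 0) + (if δ = m then -2 * g δ else 0) + (if δ = 2 * m then 5 * g δ else 0) +
      (if δ = 4 * m then -2 * g δ else 0)) := by
  rw [hr, thetaBody]; split_ifs <;> ring

/-- `Σ_δ r_δ g(δ)` for the theta vector, whenever `1,2,4,m,2m,4m` are divisors of the level. -/
theorem sum_theta_weight {N m : ℕ} (h1 : 1 ∈ N.divisors) (h2 : 2 ∈ N.divisors) (h4 : 4 ∈ N.divisors)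
    (hm : m ∈ N.divisors) (h2m : 2 * m ∈ N.divisors) (h4m : 4 * m ∈ N.divisors)
    (r : ℕ → ℤ) (hr : ∀ t, r t = 2 * thetaBody m t) (g : ℕ → ℤ) :
    ∑ δ ∈ N.divisors, r δ * g δ =
      2 * (2 * g 1 - 5 * g 2 + 2 * g 4 - 2 * g m + 5 * g (2 * m) - 2 * g (4 * m)) := by
  rw [Finset.sum_congr rfl fun δ _ => theta_mul_weight m r hr g δ, ← Finset.mul_sum]
  simp only [Finset.sum_add_distrib, Finset.sum_ite_eq', h1, h2, h4, hm, h2m, h4m, if_true]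
  ring

/-- A divisor of `k·m` (`k, m > 0`) is a member of `(k·m).divisors`. -/
theorem mem_divisors_of_dvd_mul {a k m : ℕ} (hm : 0 < m) (hk : 0 < k) (h : a ∣ k * m) : a ∈ (k * m).divisors :=
  Nat.mem_divisors.mpr ⟨h, by positivity⟩

/-- The weight of the divisor `δ` in `cuspOrder24 N r c`. -/
def cuspWeight (N : ℕ) (c : ℤ) (δ : ℕ) : ℤ := (Int.gcd (δ : ℤ) c : ℤ) ^ 2 * ((N / δ : ℕ) : ℤ)

/-- `cuspOrder24` as the weighted sum `Σ_δ r δ · cuspWeight N c δ`. -/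
theorem cuspOrder24_eq_sum_cuspWeight (N : ℕ) (r : ℕ → ℤ) (c : ℤ) :
    cuspOrder24 N r c = ∑ δ ∈ N.divisors, r δ * cuspWeight N c δ := by
  unfold cuspOrder24 cuspWeight
  exact Finset.sum_congr rfl fun δ _ => by ring

/-- `gcd(2^j·u, 2^i·v) = 2^{min(j,i)} · gcd(u,v)` for odd `u, v`. -/
theorem gcd_two_pow_mul_odd_two_pow_mul_odd {j i u v : ℕ} (hu : Odd u) (hv : Odd v) :
    Nat.gcd (2 ^ j * u) (2 ^ i * v) = 2 ^ min j i * Nat.gcd u v := by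
  have hiu : Nat.Coprime (2 ^ i) u := (Nat.coprime_two_left.mpr hu).pow_left _
  have hiv : Nat.Coprime (2 ^ i) v := (Nat.coprime_two_left.mpr hv).pow_left _
  have hju : Nat.Coprime (2 ^ j) u := (Nat.coprime_two_left.mpr hu).pow_left _
  have hjv : Nat.Coprime (2 ^ j) v := (Nat.coprime_two_left.mpr hv).pow_left _
  rw [Nat.Coprime.gcd_mul _ hiv, Nat.gcd_comm (2 ^ j * u) (2 ^ i), Nat.Coprime.gcd_mul _ hju,
    two_pow_gcd_two_pow, hiu.gcd_eq_one, Nat.gcd_comm (2 ^ j * u) v, Nat.Coprime.gcd_mul _ hju,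
    hjv.symm.gcd_eq_one, Nat.gcd_comm v u, min_comm]
  ring

/-- Closed form of the cusp orders of `Θ_m` on `X₀(8m)` at `c = 2^i c'`, `c'` odd. -/
theorem cuspOrder24_theta_eight {m : ℕ} (hm : Odd m) (r : ℕ → ℤ) (hr : ∀ t, r t = 2 * thetaBody m t)
    {i c' : ℕ} (hc' : Odd c') (hc'm : c' ∣ m) :
    cuspOrder24 (8 * m) r ((2 ^ i * c' : ℕ) : ℤ) =
      8 * ((m : ℤ) - (c' : ℤ) ^ 2) * (4 - 5 * ((2 : ℤ) ^ min 1 i) ^ 2 + ((2 : ℤ) ^ min 2 i) ^ 2) := by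
  have hm0 : 0 < m := hm.pos
  have G2 : Nat.gcd 2 (2 ^ i * c') = 2 ^ min 1 i := by
    simpa using gcd_two_pow_mul_odd_two_pow_mul_odd (j := 1) (i := i) odd_one hc'
  have G4 : Nat.gcd 4 (2 ^ i * c') = 2 ^ min 2 i := by
    simpa using gcd_two_pow_mul_odd_two_pow_mul_odd (j := 2) (i := i) odd_one hc'
  have Gm : Nat.gcd m (2 ^ i * c') = c' := by
    simpa [Nat.gcd_eq_right hc'm] using gcd_two_pow_mul_odd_two_pow_mul_odd (j := 0) (i := i) hm hc'
  have G2m : Nat.gcd (2 * m) (2 ^ i * c') = 2 ^ min 1 i * c' := by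
    simpa [Nat.gcd_eq_right hc'm] using gcd_two_pow_mul_odd_two_pow_mul_odd (j := 1) (i := i) hm hc'
  have G4m : Nat.gcd (4 * m) (2 ^ i * c') = 2 ^ min 2 i * c' := by
    simpa [Nat.gcd_eq_right hc'm] using gcd_two_pow_mul_odd_two_pow_mul_odd (j := 2) (i := i) hm hc'
  have D2 : 8 * m / 2 = 4 * m := by omega
  have D4 : 8 * m / 4 = 2 * m := by omega
  have Dm : 8 * m / m = 8 := Nat.mul_div_cancel 8 hm0
  have D2m : 8 * m / (2 * m) = 4 := by rw [show 8 * m = 4 * (2 * m) by ring]; exact Nat.mul_div_cancel 4 (by omega)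
  have D4m : 8 * m / (4 * m) = 2 := by rw [show 8 * m = 2 * (4 * m) by ring]; exact Nat.mul_div_cancel 2 (by omega)
  have H : cuspOrder24 (8 * m) r ((2 ^ i * c' : ℕ) : ℤ) =
      2 * (2 * cuspWeight (8 * m) ((2 ^ i * c' : ℕ) : ℤ) 1 - 5 * cuspWeight (8 * m) ((2 ^ i * c' : ℕ) : ℤ) 2 +
        2 * cuspWeight (8 * m) ((2 ^ i * c' : ℕ) : ℤ) 4 - 2 * cuspWeight (8 * m) ((2 ^ i * c' : ℕ) : ℤ) m +
        5 * cuspWeight (8 * m) ((2 ^ i * c' : ℕ) : ℤ) (2 * m) - 2 * cuspWeight (8 * m) ((2 ^ i * c' : ℕ) : ℤ) (4 * m)) := by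
    rw [cuspOrder24_eq_sum_cuspWeight]
    exact sum_theta_weight (mem_divisors_of_dvd_mul hm0 (by norm_num) ⟨8 * m, by ring⟩)
      (mem_divisors_of_dvd_mul hm0 (by norm_num) ⟨4 * m, by ring⟩)
      (mem_divisors_of_dvd_mul hm0 (by norm_num) ⟨2 * m, by ring⟩)
      (mem_divisors_of_dvd_mul hm0 (by norm_num) ⟨8, by ring⟩)
      (mem_divisors_of_dvd_mul hm0 (by norm_num) ⟨4, by ring⟩)
      (mem_divisors_of_dvd_mul hm0 (by norm_num) ⟨2, by ring⟩) r hr _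
  rw [H]
  simp only [cuspWeight, Int.gcd_natCast_natCast, Nat.gcd_one_left, Nat.div_one, G2, G4, Gm, G2m, G4m, D2, D4, Dm,
    D2m, D4m]
  push_cast
  ring

/-- Closed form of the cusp orders of `Θ_m` on `X₀(4m)` at `c = 2^i c'`, `c'` odd. -/
theorem cuspOrder24_theta_four {m : ℕ} (hm : Odd m) (r : ℕ → ℤ) (hr : ∀ t, r t = 2 * thetaBody m t)
    {i c' : ℕ} (hc' : Odd c') (hc'm : c' ∣ m) :
    cuspOrder24 (4 * m) r ((2 ^ i * c' : ℕ) : ℤ) =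
      4 * ((m : ℤ) - (c' : ℤ) ^ 2) * (4 - 5 * ((2 : ℤ) ^ min 1 i) ^ 2 + ((2 : ℤ) ^ min 2 i) ^ 2) := by
  have hm0 : 0 < m := hm.pos
  have G2 : Nat.gcd 2 (2 ^ i * c') = 2 ^ min 1 i := by
    simpa using gcd_two_pow_mul_odd_two_pow_mul_odd (j := 1) (i := i) odd_one hc'
  have G4 : Nat.gcd 4 (2 ^ i * c') = 2 ^ min 2 i := by
    simpa using gcd_two_pow_mul_odd_two_pow_mul_odd (j := 2) (i := i) odd_one hc'
  have Gm : Nat.gcd m (2 ^ i * c') = c' := by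
    simpa [Nat.gcd_eq_right hc'm] using gcd_two_pow_mul_odd_two_pow_mul_odd (j := 0) (i := i) hm hc'
  have G2m : Nat.gcd (2 * m) (2 ^ i * c') = 2 ^ min 1 i * c' := by
    simpa [Nat.gcd_eq_right hc'm] using gcd_two_pow_mul_odd_two_pow_mul_odd (j := 1) (i := i) hm hc'
  have G4m : Nat.gcd (4 * m) (2 ^ i * c') = 2 ^ min 2 i * c' := by
    simpa [Nat.gcd_eq_right hc'm] using gcd_two_pow_mul_odd_two_pow_mul_odd (j := 2) (i := i) hm hc'
  have D2 : 4 * m / 2 = 2 * m := by omega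
  have D4 : 4 * m / 4 = m := by omega
  have Dm : 4 * m / m = 4 := Nat.mul_div_cancel 4 hm0
  have D2m : 4 * m / (2 * m) = 2 := by rw [show 4 * m = 2 * (2 * m) by ring]; exact Nat.mul_div_cancel 2 (by omega)
  have D4m : 4 * m / (4 * m) = 1 := Nat.div_self (by omega)
  have H : cuspOrder24 (4 * m) r ((2 ^ i * c' : ℕ) : ℤ) =
      2 * (2 * cuspWeight (4 * m) ((2 ^ i * c' : ℕ) : ℤ) 1 - 5 * cuspWeight (4 * m) ((2 ^ i * c' : ℕ) : ℤ) 2 +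
        2 * cuspWeight (4 * m) ((2 ^ i * c' : ℕ) : ℤ) 4 - 2 * cuspWeight (4 * m) ((2 ^ i * c' : ℕ) : ℤ) m +
        5 * cuspWeight (4 * m) ((2 ^ i * c' : ℕ) : ℤ) (2 * m) - 2 * cuspWeight (4 * m) ((2 ^ i * c' : ℕ) : ℤ) (4 * m)) := by
    rw [cuspOrder24_eq_sum_cuspWeight]
    exact sum_theta_weight (mem_divisors_of_dvd_mul hm0 (by norm_num) ⟨4 * m, by ring⟩)
      (mem_divisors_of_dvd_mul hm0 (by norm_num) ⟨2 * m, by ring⟩)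
      (mem_divisors_of_dvd_mul hm0 (by norm_num) ⟨m, by ring⟩)
      (mem_divisors_of_dvd_mul hm0 (by norm_num) ⟨4, by ring⟩)
      (mem_divisors_of_dvd_mul hm0 (by norm_num) ⟨2, by ring⟩)
      (mem_divisors_of_dvd_mul hm0 (by norm_num) ⟨1, by ring⟩) r hr _
  rw [H]
  simp only [cuspWeight, Int.gcd_natCast_natCast, Nat.gcd_one_left, Nat.div_one, G2, G4, Gm, G2m, G4m, D2, D4, Dm,
    D2m, D4m]
  push_cast
  ring

/-- Newman's conditions for `Θ_m` on `X₀(8m)` (weight `0`). -/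
theorem newmanCond_theta_eight {m : ℕ} (hm : Odd m) (r : ℕ → ℤ) (hr : ∀ t, r t = 2 * thetaBody m t) :
    NewmanCond (8 * m) r 0 := by
  have hm0 : 0 < m := hm.pos
  have h1 : 1 ∈ (8 * m).divisors := mem_divisors_of_dvd_mul hm0 (by norm_num) ⟨8 * m, by ring⟩
  have h2 : 2 ∈ (8 * m).divisors := mem_divisors_of_dvd_mul hm0 (by norm_num) ⟨4 * m, by ring⟩
  have h4 : 4 ∈ (8 * m).divisors := mem_divisors_of_dvd_mul hm0 (by norm_num) ⟨2 * m, by ring⟩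
  have hmm : m ∈ (8 * m).divisors := mem_divisors_of_dvd_mul hm0 (by norm_num) ⟨8, by ring⟩
  have h2m : 2 * m ∈ (8 * m).divisors := mem_divisors_of_dvd_mul hm0 (by norm_num) ⟨4, by ring⟩
  have h4m : 4 * m ∈ (8 * m).divisors := mem_divisors_of_dvd_mul hm0 (by norm_num) ⟨2, by ring⟩
  have D2 : 8 * m / 2 = 4 * m := by omega
  have D4 : 8 * m / 4 = 2 * m := by omega
  have Dm : 8 * m / m = 8 := Nat.mul_div_cancel 8 hm0
  have D2m : 8 * m / (2 * m) = 4 := by rw [show 8 * m = 4 * (2 * m) by ring]; exact Nat.mul_div_cancel 4 (by omega)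
  have D4m : 8 * m / (4 * m) = 2 := by rw [show 8 * m = 2 * (4 * m) by ring]; exact Nat.mul_div_cancel 2 (by omega)
  refine ⟨?_, ?_, ?_, ?_⟩
  · have H : ∑ δ ∈ (8 * m).divisors, r δ * 1 = 2 * (2 * 1 - 5 * 1 + 2 * 1 - 2 * 1 + 5 * 1 - 2 * 1) :=
      sum_theta_weight h1 h2 h4 hmm h2m h4m r hr (fun _ => 1)
    simpa using H
  · have H : ∑ δ ∈ (8 * m).divisors, r δ * (δ : ℤ) =
        2 * (2 * ((1 : ℕ) : ℤ) - 5 * ((2 : ℕ) : ℤ) + 2 * ((4 : ℕ) : ℤ) - 2 * ((m : ℕ) : ℤ) +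
          5 * ((2 * m : ℕ) : ℤ) - 2 * ((4 * m : ℕ) : ℤ)) :=
      sum_theta_weight h1 h2 h4 hmm h2m h4m r hr (fun δ => (δ : ℤ))
    rw [Finset.sum_congr rfl fun (δ : ℕ) _ => mul_comm ((δ : ℕ) : ℤ) (r δ), H]
    exact ⟨0, by push_cast; ring⟩
  · have H : ∑ δ ∈ (8 * m).divisors, r δ * ((8 * m / δ : ℕ) : ℤ) =
        2 * (2 * ((8 * m / 1 : ℕ) : ℤ) - 5 * ((8 * m / 2 : ℕ) : ℤ) + 2 * ((8 * m / 4 : ℕ) : ℤ) -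
          2 * ((8 * m / m : ℕ) : ℤ) + 5 * ((8 * m / (2 * m) : ℕ) : ℤ) - 2 * ((8 * m / (4 * m) : ℕ) : ℤ)) :=
      sum_theta_weight h1 h2 h4 hmm h2m h4m r hr (fun δ => ((8 * m / δ : ℕ) : ℤ))
    rw [Finset.sum_congr rfl fun (δ : ℕ) _ => mul_comm (((8 * m / δ : ℕ) : ℤ)) (r δ), H, Nat.div_one, D2, D4, Dm, D2m, D4m]
    exact ⟨0, by push_cast; ring⟩
  · refine ⟨∏ δ ∈ (8 * m).divisors, δ ^ (thetaBody m δ).natAbs, ?_⟩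
    rw [← Finset.prod_mul_distrib]
    refine Finset.prod_congr rfl fun δ _ => ?_
    rw [hr, Int.natAbs_mul, show (2 : ℤ).natAbs = 2 from rfl, two_mul, pow_add]

/-- From `m = c' q` odd: the gcd `g = gcd(c', q)` is odd and divides `q - c'`, which is even. -/
theorem theta_gcd_facts {m c' q : ℕ} (hm : Odd m) (hc' : Odd c') (hmq : m = c' * q) :
    Odd q ∧ Odd (Nat.gcd c' q) ∧ ((Nat.gcd c' q : ℕ) : ℤ) ∣ (q : ℤ) - c' ∧ (2 : ℤ) ∣ (q : ℤ) - c' := by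
  have hq : Odd q := by rw [hmq] at hm; exact (Nat.odd_mul.mp hm).2
  refine ⟨hq, Odd.of_dvd_nat hc' (Nat.gcd_dvd_left _ _), ?_, ?_⟩
  · exact dvd_sub (Int.natCast_dvd_natCast.mpr (Nat.gcd_dvd_right _ _))
      (Int.natCast_dvd_natCast.mpr (Nat.gcd_dvd_left _ _))
  · obtain ⟨a, ha⟩ := hq
    obtain ⟨b, hb⟩ := hc'
    exact ⟨(a : ℤ) - b, by rw [ha, hb]; push_cast; ring⟩

/-- Even (integral) cusp orders of `Θ_m` on `X₀(8m)`. -/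
theorem hasEvenCuspOrders_theta_eight {m : ℕ} (hm : Odd m) (r : ℕ → ℤ) (hr : ∀ t, r t = 2 * thetaBody m t) :
    HasEvenCuspOrders (8 * m) r := by
  intro c hc
  have hm0 : 0 < m := hm.pos
  have h8 : 8 * m = 2 ^ 3 * m := by norm_num
  have hcN : c ∣ 2 ^ 3 * m := h8 ▸ Nat.dvd_of_mem_divisors hc
  obtain ⟨hdec, hodd, hu, hj⟩ := divisor_two_adic hm hcN
  have hdiv := two_pow_mul_div hm hcN
  rw [← h8] at hdiv
  generalize ordCompl[2] c = c' at hdec hodd hu hdiv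
  generalize c.factorization 2 = i at hdec hj hdiv
  subst hdec
  obtain ⟨q, hmq⟩ := hu
  obtain ⟨hq, hg, hgd, h2d⟩ := theta_gcd_facts hm hodd hmq
  have hmc : m / c' = q := by rw [hmq, Nat.mul_div_cancel_left q hodd.pos]
  rw [hmc] at hdiv
  have hcop : IsCoprime (2 : ℤ) ((Nat.gcd c' q : ℕ) : ℤ) := Nat.isCoprime_iff_coprime.mpr (Nat.coprime_two_left.mpr hg)
  obtain ⟨s, hs⟩ := IsCoprime.mul_dvd hcop h2d hgd
  rw [hdiv, gcd_two_pow_mul_odd_two_pow_mul_odd hodd hq, cuspOrder24_theta_eight hm r hr hodd ⟨q, hmq⟩]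
  interval_cases i
  · rw [show (4 : ℤ) - 5 * (2 ^ min 1 0) ^ 2 + (2 ^ min 2 0) ^ 2 = 0 by norm_num [Nat.min_def], mul_zero]
    exact dvd_zero _
  · rw [show (4 : ℤ) - 5 * (2 ^ min 1 1) ^ 2 + (2 ^ min 2 1) ^ 2 = -12 by norm_num [Nat.min_def],
      show min 1 (3 - 1) = 1 by norm_num]
    refine ⟨-s, ?_⟩
    rw [hmq]; push_cast
    linear_combination (-96 * (c' : ℤ)) * hs
  · rw [show (4 : ℤ) - 5 * (2 ^ min 1 2) ^ 2 + (2 ^ min 2 2) ^ 2 = 0 by norm_num [Nat.min_def], mul_zero]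
    exact dvd_zero _
  · rw [show (4 : ℤ) - 5 * (2 ^ min 1 3) ^ 2 + (2 ^ min 2 3) ^ 2 = 0 by norm_num [Nat.min_def], mul_zero]
    exact dvd_zero _

/-- Even (integral) cusp orders of `Θ_m` on `X₀(4m)` iff `m ≡ 1 (mod 4)`. -/
theorem hasEvenCuspOrders_theta_four_iff {m : ℕ} (hm : Odd m) (r : ℕ → ℤ) (hr : ∀ t, r t = 2 * thetaBody m t) :
    m % 4 = 1 ↔ HasEvenCuspOrders (4 * m) r := by
  have hm0 : 0 < m := hm.pos
  have h4 : 4 * m = 2 ^ 2 * m := by norm_num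
  constructor
  · intro hm1 c hc
    have hcN : c ∣ 2 ^ 2 * m := h4 ▸ Nat.dvd_of_mem_divisors hc
    obtain ⟨hdec, hodd, hu, hj⟩ := divisor_two_adic hm hcN
    have hdiv := two_pow_mul_div hm hcN
    rw [← h4] at hdiv
    generalize ordCompl[2] c = c' at hdec hodd hu hdiv
    generalize c.factorization 2 = i at hdec hj hdiv
    subst hdec
    obtain ⟨q, hmq⟩ := hu
    obtain ⟨hq, hg, hgd, -⟩ := theta_gcd_facts hm hodd hmq
    have hmc : m / c' = q := by rw [hmq, Nat.mul_div_cancel_left q hodd.pos]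
    rw [hmc] at hdiv
    -- `4 ∣ q - c'` from `m = c' q ≡ 1 (mod 4)` and `c'` odd
    have h4m1 : (4 : ℤ) ∣ (m : ℤ) - 1 := ⟨((m / 4 : ℕ) : ℤ), by omega⟩
    have h4sq : (4 : ℤ) ∣ (c' : ℤ) ^ 2 - 1 := by
      obtain ⟨b, hb⟩ := hodd
      exact ⟨(b : ℤ) * (b + 1), by rw [hb]; push_cast; ring⟩
    have h4d : (4 : ℤ) ∣ (q : ℤ) - c' := by
      have e : (q : ℤ) - c' = (c' : ℤ) * ((m : ℤ) - 1) - (q : ℤ) * ((c' : ℤ) ^ 2 - 1) := by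
        rw [hmq]; push_cast; ring
      rw [e]
      exact dvd_sub (dvd_mul_of_dvd_right h4m1 _) (dvd_mul_of_dvd_right h4sq _)
    have hcop4 : IsCoprime (4 : ℤ) ((Nat.gcd c' q : ℕ) : ℤ) := by
      have h := Nat.isCoprime_iff_coprime.mpr ((Nat.coprime_two_left.mpr hg).pow_left 2)
      simpa using h
    obtain ⟨s, hs⟩ := IsCoprime.mul_dvd hcop4 h4d hgd
    rw [hdiv, gcd_two_pow_mul_odd_two_pow_mul_odd hodd hq, cuspOrder24_theta_four hm r hr hodd ⟨q, hmq⟩]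
    interval_cases i
    · rw [show (4 : ℤ) - 5 * (2 ^ min 1 0) ^ 2 + (2 ^ min 2 0) ^ 2 = 0 by norm_num [Nat.min_def], mul_zero]
      exact dvd_zero _
    · rw [show (4 : ℤ) - 5 * (2 ^ min 1 1) ^ 2 + (2 ^ min 2 1) ^ 2 = -12 by norm_num [Nat.min_def],
        show min 1 (2 - 1) = 1 by norm_num]
      refine ⟨-s, ?_⟩
      rw [hmq]; push_cast
      linear_combination (-48 * (c' : ℤ)) * hs
    · rw [show (4 : ℤ) - 5 * (2 ^ min 1 2) ^ 2 + (2 ^ min 2 2) ^ 2 = 0 by norm_num [Nat.min_def], mul_zero]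
      exact dvd_zero _
  · intro hev
    have h2mem : 2 ∈ (4 * m).divisors := mem_divisors_of_dvd_mul hm0 (by norm_num) ⟨2 * m, by ring⟩
    have h := hev 2 h2mem
    rw [show 4 * m / 2 = 2 * m by omega, Nat.gcd_eq_left (⟨m, rfl⟩ : 2 ∣ 2 * m)] at h
    have hco : cuspOrder24 (4 * m) r ((2 ^ 1 * 1 : ℕ) : ℤ) = 4 * ((m : ℤ) - 1) * (-12) := by
      rw [cuspOrder24_theta_four hm r hr odd_one (one_dvd m)]
      norm_num [Nat.min_def]
    rw [show ((2 : ℕ) : ℤ) = ((2 ^ 1 * 1 : ℕ) : ℤ) by norm_num, hco] at h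
    obtain ⟨k, hk⟩ := h
    push_cast at hk
    obtain ⟨t, ht⟩ := hm
    omega

/-- **E-an-157, statement spelled out** (the body of `SigmaTheta.ThetaFamilyIntegral`, for any `r` pointwise equal to
`2·thetaVec m`): integrality of the theta family. -/
theorem thetaFamily_integral (m : ℕ) (hm : Odd m) (r : ℕ → ℤ) (hr : ∀ t, r t = 2 * thetaBody m t) :
    (NewmanCond (8 * m) r 0 ∧ HasEvenCuspOrders (8 * m) r) ∧ (m % 4 = 1 ↔ HasEvenCuspOrders (4 * m) r) :=
  ⟨⟨newmanCond_theta_eight hm r hr, hasEvenCuspOrders_theta_eight hm r hr⟩, hasEvenCuspOrders_theta_four_iff hm r hr⟩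

end ThetaFamily

end Summit.BirchSwinnertonDyer.Rank1Residual.ManinAdditive.SigmaEta
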